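import Summits.Langlands.Langlands.Theses.CyclicDeinductionCarving
import Summits.Langlands.Langlands.Theorems.CyclicDeinductionDarkPrimitiveAvatars
import Summits.Langlands.Langlands.Theorems.CyclicDeinductionCarvingInducedPreAvatar
import Literature.NumberTheory.GaloisRepresentations.HeckeCharacter
import Literature.NumberTheory.Automorphic.AutomorphicRepsGLSatakeFlathProofs
import Literature.NumberTheory.Automorphic.ArtinLFunctionsAbelianProofs
import Literature.NumberTheory.Automorphic.BookerKrishnamurthyConverse
import HarnessLib

/-!
# `TwistOrbitUnmixing` — UNMIX = `CyclicDeinductionCarving.ConjugateUnmixing` ⟺ TOP ∧ CTU, by the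
# NORMAL FORM OF A MINIMAL COUNTEREXAMPLE TO UNMIXING (decomp-langlands lens-4 «minimal counterexample», gen 40)

TARGET (by name).  `Summit.Langlands.Langlands.Theses.CyclicDeinductionCarving.ConjugateUnmixing`
(stmt-Langlands-27503, crux r2, leaf IDEA-NEEDED of the DRAFT route `CyclicDeinductionCarving`, which
refines `RootDecomp1.DarkPrimitiveAvatars` = G, stmt-Langlands-29147; lineage Langlands ⟸ … ⟸ E =
`RootDecomp1.SemisimpleAvatar` 23598 ⟸ G ⟸ G⁺ ∧ UNMIX ∧ IND, IND PROVED).  UNMIX: for `K/K₀` cyclic of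
prime degree `p` and `π` cuspidal `L`-algebraic on `GL_m/K`, a PRE-AVATAR `r` of `π` (a semisimple
`Γ_K → GL_m(ℚ̄_ℓ)` whose Frobenius polynomials above a.e. place `v` of `K₀` have the right PRODUCT
`∏_{w∣v} Q_w(X^{f_w}) = ∏_{w∣v} P^ι_{π,w}(X^{f_w})`) can be UNMIXED: `π` has a semisimple a.e. avatar.

THESIS (lens 4: push the structure of a minimal counterexample until it names the missing object).
(1) WHERE a counterexample lives.  At an inert `v` the identity already aligns `r` with `π`
(`preAvatar_compatible_of_unique_over`, PROVED); at a split `v` it only says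
`⋃_i eig r(Frob_{σ^i w}) = ⋃_i roots P_{π,σ^i w}` — the `p` conjugate places may be INTERLACED.
(2) WHAT kills interlacing at `w`: one finite-order Hecke character `χ` of `K` with `χ(ϖ_{σw}) ≠ χ(ϖ_w)`
for which the `χ`-TWISTED identity `⋃_i χ(ϖ_{σ^i w})·eig r_χ(Frob_{σ^i w}) = ⋃_i χ(ϖ_{σ^i w})·roots P_{π,σ^i w}`
is also available: comparing the two identities for `χ` of prime order `t > 16 m²` separates the
blocks (Taylor's trick — Taylor, Invent. Math. 116 (1994) §3 Lemma 2 ff.; Harris–Lan–Taylor–Thorne,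
RMS 3 (2016) Prop. 7.12; Blasius–Harris eliminability), and a Chebotarev/ray-class supply of such `χ`
plus finite-candidate gluing reaches a.e. `w` — ALL OF WHICH IS IN THE TREE for the quadratic
totally-real window: `Theorems.TwistUnpackaging_proof` (crux `QuadraticWindow.TwistUnpackaging`,
stmt-Langlands-10903, PROVED; stubs `RayClassTwist`, `AvatarPowers`, `CyclicUnscrewing` =
`Literature…TwistedSum.exists_framedRep_of_cyclic_twist`, `FiniteCandidateGluing`, `Assembly`), and is
the engine `PrimeStepPackageDescent` (PSPD) of the draft route `PrimeTwistSeparationLadder`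
(stmt-Langlands-28517/28518) for cyclic prime degree.
(3) The NORMAL FORM of a minimal counterexample, hence the missing object.  Suppose twisted identities
are available for every `χ`, but each only off its OWN finite set `T_χ`.  Take a tower `K ⊂ L₁ ⊂ L₂ ⊂ …`
of finite extensions Galois over `K₀` exhausting `K̄`, and `w_n` a place of `K` split completely in
`L_n`: every fixed `χ` is trivial at `w_n` and at `σ w_n` for `n ≫ 0` (`χ` factors through some
`Gal(L_n/K)`), so each `χ` separates only FINITELY many `w_n`, and the sets `T_χ` may swallow them:
per-twist packages cannot exclude a counterexample interlaced exactly along such a Chebotarev-sparse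
sequence.  Conversely, if ONE finite `T` works for all `χ`, every split `w ∉ T` is separated by
infinitely many `χ` of large prime order unramified above `w ∩ K₀` (Grunwald–Wang), and the
unscrewing closes.  So the object a proof of UNMIX must produce is EXACTLY a UNIFORM twist-orbit
package family — piece TOP below — and given it, UNMIX is PRINT-grade — piece CTU.

PIECES (both certified WEAKER than UNMIX by kernel; UNMIX ⟺ TOP ∧ CTU by kernel).
* TOP = `TwistOrbitPackages` — NEW RESIDUAL ATOM · WEAKER (`twistOrbitPackages_of_conjugateUnmixing`:
  the avatar `ρ` is a package for every `χ`, uniformly) · UNMIX-equivalent GIVEN CTU · leaf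
  IDEA-NEEDED in the dark sector (it asks, for every finite-order `χ` NOT descending to `K₀`, a
  pre-avatar of `π ⊗ χ`, i.e. an avatar-grade statement about `AI_{K/K₀}(π ⊗ χ)`, with an exceptional
  set independent of `χ`) · INSTRUMENTABLE in every lit sector (full local–global compatibility at the
  unramified places, Caraiani 2012/14, gives `χ`-uniform packages wherever `AI(π ⊗ χ)` is accessible).
  Typed UNTWISTED («format X»): a package for `χ` above `v` is a semisimple `r_χ : Γ_K → GL_m(ℚ̄_ℓ)`
  whose Frobenius polynomials above `v`, given in Satake form `P^ι(γ_w)`, satisfy the `χ`-twisted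
  product identity `∏_{w∣v} P^ι(χ(ϖ_w)·γ_w)(X^{f_w}) = ∏_{w∣v} P^ι(χ(ϖ_w)·β_w)(X^{f_w})` (`β_w` the Satake
  parameter of `π` at `w`; `χ(ϖ_w)·β_w` is the Satake parameter of `π ⊗ χ` at `w` unramified for `χ`,
  `Literature…HasSatakeParamAt.twist`); i.e. `r_χ ⊗ χ̃_ℓ` is a pre-avatar of `π ⊗ χ`.  The untwisted
  format makes the Langlands-necessity certificate twist-free (`γ := β`, witness `ρ` for all `χ`).
* CTU = `CyclicTwistUnscrewing` — PRINT-grade mod port · WEAKER (`cyclicTwistUnscrewing_of_conjugateUnmixing`: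
  the `χ = 1` package is a pre-avatar) · leaf ATTACKABLE NOW · = CTU₂ ∧ CTU_odd by kernel
  (`cyclicTwistUnscrewing_iff_two_odd`): CTU₂ (`p = 2`) is the tree theorem `TwistUnpackaging_proof`
  re-typed (drop the window hypotheses `hTR … hunr`, which its Core form does not use; replace the
  Artin-avatar packages `eψ` by Hecke characters via `HeckeCharacter.exists_framedArtinRep_of_isFiniteOrder`
  and `FramedArtinRep.lAdicChar`; est. S–M); CTU_odd (`p` odd) is PSPD's engine: `p`-term cyclic
  unscrewing `exists_framedRep_of_cyclic_twist` with `d := m`, generic exponent `t > 16 m²`, or the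
  two-package restriction rigidity of `PrimeTwistSeparationLadder` (est. M–L).
NOT NEEDED for UNMIX (count-relevant census correction): any un-inducing input of direction (B), any
automorphy over `K₀` beyond the packages, any irreducibility of avatars — the host docstring's «every
un-inducing device in print uses direction (B)» is superseded: the device is (2), direction (A) only.

KERNEL (0 sorry): `conjugateUnmixing_of_pieces` (TOP → CTU → UNMIX), `twistOrbitPackages_of_conjugateUnmixing`,
`cyclicTwistUnscrewing_of_conjugateUnmixing`, `conjugateUnmixing_iff_pieces` (UNMIX ↔ TOP ∧ CTU),
`cyclicTwistUnscrewing_iff_two_odd`, `pieces_of_semisimpleAvatar` (E ⇒ TOP ∧ CTU).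

WHY NOVEL.  First refinement of UNMIX (27503); no route, node or card types the twist-orbit package
family for the dark cyclic layer or the uniformity clause; the cell's twist-unscrewing statements
(`QuadraticWindow.TwistUnpackaging`, `PrimeTwistSeparationLadder`) ASSUME lit packages inside an
accessible window / a given induced family over `K₀` and conclude descent THERE — here the same engine is
pointed at the dark de-induction crux and the residual is isolated as a supply statement with a proved
exactness `UNMIX ⟺ TOP ∧ CTU`.  Delta to lens-4 g0–g39: those normalise the counterexample to E/AvDesc by
field, rank, weight or self-twist; this one normalises the counterexample to UNMIXING by its set of
interlaced places (Chebotarev-sparse) and reads off the uniform package family as the missing object.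

WHY EACH PIECE IS STRICTLY WEAKER THAN UNMIX / Langlands.  TOP ⟸ UNMIX and CTU ⟸ UNMIX are kernel
theorems below; UNMIX ⟸ E ⟸ Langlands (`conjugateUnmixing_of_semisimpleAvatar`, host).  Neither converse is
cheap: TOP → UNMIX is CTU (Taylor's trick + supply + gluing, some hundred tree declarations for `p = 2`),
CTU → UNMIX is TOP (open in the dark sector); the probes `TwistOrbitUnmixing.probes.lean` record that
no tactic battery closes TOP → UNMIX, CTU → UNMIX, TOP → Langlands, CTU → Langlands.
-/

set_option linter.dupNamespace false
set_option linter.unusedVariables false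
set_option linter.style.longLine false

open scoped NumberField Classical Polynomial
open Filter IsDedekindDomain Polynomial
open Literature.NumberTheory.Automorphic Literature.NumberTheory.GaloisRepresentations
open Summit.Langlands.Langlands.Theses

namespace Summit.Langlands.Langlands.Theorems.TwistOrbitUnmixing

section Defs

variable {K₀ : Type} [Field K₀] [NumberField K₀] {K : Type} [Field K] [NumberField K] [Algebra K₀ K]
  {m : ℕ} {hK : isCompact_glFiniteIntegralLevel m K} {ℓ : ℕ} [Fact ℓ.Prime]

/-- **The pre-avatar identity above `v`** (UNMIX's hypothesis at one place `v` of `K₀`, VERBATIM): for every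
choice of Satake parameters `β_w` of `P` at the places `w ∣ v` there are Frobenius polynomials `Q_w` of `r`
(unramified) at the `w ∣ v` with `∏_{w∣v} Q_w(X^{f_w}) = ∏_{w∣v} P^ι(β_w)(X^{f_w})`. [ref: route
CyclicDeinductionCarving, decl ConjugateUnmixing; Arthur–Clozel 1989 Ch. 3 §6] -/
def PreAvatarIdentityAt (K₀ : Type) [Field K₀] [NumberField K₀] [Algebra K₀ K] (ι : PadicAlgCl ℓ ≃+* ℂ)
    (P : AutomorphicRepData (AutomorphyDatum.gl m K hK)) (r : FramedGaloisRep K (PadicAlgCl ℓ) m)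
    (v : HeightOneSpectrum (𝓞 K₀)) : Prop :=
  ∀ β : HeightOneSpectrum (𝓞 K) → Multiset ℂ,
    (∀ w : HeightOneSpectrum (𝓞 K), w.asIdeal.under (𝓞 K₀) = v.asIdeal → P.HasSatakeParamAt w (β w)) →
    ∃ Q : HeightOneSpectrum (𝓞 K) → Polynomial (PadicAlgCl ℓ),
      (∀ w : HeightOneSpectrum (𝓞 K), w.asIdeal.under (𝓞 K₀) = v.asIdeal →
        r.IsUnramifiedAt w ∧ r.HasFrobCharpolyAt w (Q w)) ∧
      ∏ᶠ w ∈ {w : HeightOneSpectrum (𝓞 K) | w.asIdeal.under (𝓞 K₀) = v.asIdeal},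
          (Q w).comp (Polynomial.X ^ w.asIdeal.inertiaDeg (𝓞 K₀)) =
        ∏ᶠ w ∈ {w : HeightOneSpectrum (𝓞 K) | w.asIdeal.under (𝓞 K₀) = v.asIdeal},
          (arithFrobPolyOfSatake ι w.residueCard 1 (β w)).comp (Polynomial.X ^ w.asIdeal.inertiaDeg (𝓞 K₀))

/-- **`P` has a pre-avatar along `K/K₀`** (UNMIX's hypothesis, VERBATIM): a semisimple `r : Γ_K → GL_m(ℚ̄_ℓ)`
satisfying the pre-avatar identity above all but finitely many places of `K₀`. [ref: route CyclicDeinductionCarving] -/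
def HasPreAvatar (K₀ : Type) [Field K₀] [NumberField K₀] [Algebra K₀ K] (ι : PadicAlgCl ℓ ≃+* ℂ)
    (P : AutomorphicRepData (AutomorphyDatum.gl m K hK)) : Prop :=
  ∃ r : FramedGaloisRep K (PadicAlgCl ℓ) m, r.toGaloisRep.IsSemisimple ∧
    (∀ᶠ v : HeightOneSpectrum (𝓞 K₀) in cofinite, PreAvatarIdentityAt K₀ ι P r v)

/-- **`P` has a semisimple a.e. avatar** (UNMIX's conclusion = E's conclusion, VERBATIM). [ref: Statement
`SatakeFrobCompatibleAt`; route RootDecomp1, decl SemisimpleAvatar] -/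
def HasAvatar (ι : PadicAlgCl ℓ ≃+* ℂ) (P : AutomorphicRepData (AutomorphyDatum.gl m K hK)) : Prop :=
  ∃ ρ : FramedGaloisRep K (PadicAlgCl ℓ) m, ρ.toGaloisRep.IsSemisimple ∧
    ∀ᶠ w : HeightOneSpectrum (𝓞 K) in cofinite, SatakeFrobCompatibleAt ι P ρ w

/-- **A `χ`-twisted package for `P` above `v`, recorded untwisted.**  `χ` a Hecke character of `K`,
`r : Γ_K → GL_m(ℚ̄_ℓ)`: for every choice of Satake parameters `β_w` of `P` at the `w ∣ v`, the Frobenius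
polynomials of `r` at the `w ∣ v` are unramified and of Satake form `P^ι(γ_w)`, and the `χ`-TWISTED product
identity `∏_{w∣v} P^ι(χ(ϖ_w)·γ_w)(X^{f_w}) = ∏_{w∣v} P^ι(χ(ϖ_w)·β_w)(X^{f_w})` holds — i.e. `r ⊗ χ̃_ℓ` is a
pre-avatar above `v` of the twist `P ⊗ χ` (whose Satake parameter at `w` unramified for `χ` is `χ(ϖ_w)·β_w`,
`HasSatakeParamAt.twist`).  For `χ = 1` this is `PreAvatarIdentityAt`. [ref: Taylor 1994 §3 (the packages
`R_ψ`); Harris–Lan–Taylor–Thorne 2016 §7; route QuadraticWindow, decl TwistUnpackaging (packages `B_ψ`)] -/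
def TwistPackageAt (ι : PadicAlgCl ℓ ≃+* ℂ) (P : AutomorphicRepData (AutomorphyDatum.gl m K hK))
    (χ : HeckeCharacter K) (r : FramedGaloisRep K (PadicAlgCl ℓ) m) (v : HeightOneSpectrum (𝓞 K₀)) : Prop :=
  ∀ β : HeightOneSpectrum (𝓞 K) → Multiset ℂ,
    (∀ w : HeightOneSpectrum (𝓞 K), w.asIdeal.under (𝓞 K₀) = v.asIdeal → P.HasSatakeParamAt w (β w)) →
    ∃ γ : HeightOneSpectrum (𝓞 K) → Multiset ℂ,
      (∀ w : HeightOneSpectrum (𝓞 K), w.asIdeal.under (𝓞 K₀) = v.asIdeal →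
        r.IsUnramifiedAt w ∧ r.HasFrobCharpolyAt w (arithFrobPolyOfSatake ι w.residueCard 1 (γ w))) ∧
      ∏ᶠ w ∈ {w : HeightOneSpectrum (𝓞 K) | w.asIdeal.under (𝓞 K₀) = v.asIdeal},
          (arithFrobPolyOfSatake ι w.residueCard 1 ((γ w).map (· * χ.valueAtUniformizer w))).comp
            (Polynomial.X ^ w.asIdeal.inertiaDeg (𝓞 K₀)) =
        ∏ᶠ w ∈ {w : HeightOneSpectrum (𝓞 K) | w.asIdeal.under (𝓞 K₀) = v.asIdeal},
          (arithFrobPolyOfSatake ι w.residueCard 1 ((β w).map (· * χ.valueAtUniformizer w))).comp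
            (Polynomial.X ^ w.asIdeal.inertiaDeg (𝓞 K₀))

/-- **A UNIFORM twist-orbit package family for `P` along `K/K₀`**: ONE finite set `T` of places of `K₀` and,
for every finite-order Hecke character `χ` of `K`, a semisimple `r_χ` which is a `χ`-twisted package for `P`
above every `v ∉ T` above which `χ` is unramified.  The uniformity of `T` in `χ` is the load-bearing clause
(module docstring, (3)). [ref: Taylor 1994 §3; HLTT 2016 Prop. 7.12; route PrimeTwistSeparationLadder
(typed family `P j`, common exceptional set)] -/
def UniformTwistPackages (K₀ : Type) [Field K₀] [NumberField K₀] [Algebra K₀ K] (ι : PadicAlgCl ℓ ≃+* ℂ)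
    (P : AutomorphicRepData (AutomorphyDatum.gl m K hK)) : Prop :=
  ∃ T : Set (HeightOneSpectrum (𝓞 K₀)), T.Finite ∧
    ∀ χ : HeckeCharacter K, χ.IsFiniteOrder →
      ∃ r : FramedGaloisRep K (PadicAlgCl ℓ) m, r.toGaloisRep.IsSemisimple ∧
        ∀ v : HeightOneSpectrum (𝓞 K₀), v ∉ T →
          (∀ w : HeightOneSpectrum (𝓞 K), w.asIdeal.under (𝓞 K₀) = v.asIdeal → χ.IsUnramifiedAt w) →
          TwistPackageAt ι P χ r v

end Defs

/-! ## The pieces -/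

/-- **TOP = `TwistOrbitPackages` — residual atom (rank 2) · WEAKER (`twistOrbitPackages_of_conjugateUnmixing`)
· UNMIX-equivalent given CTU · leaf IDEA-NEEDED (dark sector) / INSTRUMENTABLE (lit sectors).**
For `K/K₀` cyclic Galois of prime degree and `π` cuspidal `L`-algebraic on `GL_m/K` WITH a pre-avatar along
`K/K₀`: `π` has a uniform twist-orbit package family along `K/K₀` (for every `ℓ`, `ι`).
WHY IT MIGHT FAIL AS A LEMMA: for `χ` not descending to `K₀` a package is an avatar-grade statement about
`AI_{K/K₀}(π ⊗ χ)`, a cuspidal representation over `K₀` as dark as `AI(π)`; nothing on record produces it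
from the single pre-avatar `r` (twisting `r` only yields packages for `χ = χ₀ ∘ N_{K/K₀}`, which never
separate conjugate places); and `χ`-uniformity of the exceptional set needs local–global compatibility
at ALL unramified places (Caraiani), unknown outside the polarizable world.
[ref: Taylor, Invent. Math. 116 (1994) §3; Harris–Lan–Taylor–Thorne, Res. Math. Sci. 3 (2016) §7;
Arthur–Clozel 1989 Ch. 3 §6; Caraiani, Duke 161 (2012)] -/
def TwistOrbitPackages : Prop :=
  ∀ (K₀ : Type) [Field K₀] [NumberField K₀] (K : Type) [Field K] [NumberField K] [Algebra K₀ K],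
    IsGalois K₀ K → IsCyclic (K ≃ₐ[K₀] K) → (Module.finrank K₀ K).Prime →
    ∀ (m : ℕ) (hK : isCompact_glFiniteIntegralLevel m K), 0 < m →
    ∀ (π : CuspidalAutomorphicRepData m K hK), π.1.IsLAlgebraic →
    ∀ (ℓ : ℕ) [Fact ℓ.Prime] (ι : PadicAlgCl ℓ ≃+* ℂ),
      HasPreAvatar K₀ ι π.1 → UniformTwistPackages K₀ ι π.1

/-- **CTU = `CyclicTwistUnscrewing` — support (rank 9) · PRINT-grade mod port · WEAKER
(`cyclicTwistUnscrewing_of_conjugateUnmixing`) · leaf ATTACKABLE NOW · = CTU₂ ∧ CTU_odd.**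
For `K/K₀` cyclic Galois of prime degree and `π` cuspidal `L`-algebraic on `GL_m/K`: a uniform twist-orbit
package family along `K/K₀` can be unscrewed — `π` has a semisimple a.e. avatar.  Proof in print / tree:
Taylor's trick with `χ` of prime order `t > 16 m²` separating `w` from `σ w` (supply: ray-class characters
of `K` of conductor a prime split over `K₀`, Grunwald–Wang; `stub_rayClassTwist`), Krull–Schmidt unscrewing
(`TwistedSum.exists_framedRep_of_cyclic_twist`), finite-candidate gluing (`stub_finiteCandidateGluing`).
[ref: Taylor 1994 §3 Lemma 2–3; HLTT 2016 Prop. 7.12; tree `Theorems.TwistUnpackaging_proof`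
(stmt-Langlands-10903); route PrimeTwistSeparationLadder, stub PrimeStepPackageDescent] -/
def CyclicTwistUnscrewing : Prop :=
  ∀ (K₀ : Type) [Field K₀] [NumberField K₀] (K : Type) [Field K] [NumberField K] [Algebra K₀ K],
    IsGalois K₀ K → IsCyclic (K ≃ₐ[K₀] K) → (Module.finrank K₀ K).Prime →
    ∀ (m : ℕ) (hK : isCompact_glFiniteIntegralLevel m K), 0 < m →
    ∀ (π : CuspidalAutomorphicRepData m K hK), π.1.IsLAlgebraic →
    ∀ (ℓ : ℕ) [Fact ℓ.Prime] (ι : PadicAlgCl ℓ ≃+* ℂ),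
      UniformTwistPackages K₀ ι π.1 → HasAvatar ι π.1

/-- **CTU₂ = `QuadraticTwistUnscrewing`** — CTU for `[K:K₀] = 2` · TREE-PROVED ANALOGUE
(`Theorems.TwistUnpackaging_proof`, `QuadraticWindow.TwistUnpackaging` Core form: same engine, window
hypotheses unused) · leaf ATTACKABLE NOW (port, est. S–M). [ref: HLTT 2016 Prop. 7.12; stmt-Langlands-10903] -/
def QuadraticTwistUnscrewing : Prop :=
  ∀ (K₀ : Type) [Field K₀] [NumberField K₀] (K : Type) [Field K] [NumberField K] [Algebra K₀ K],
    IsGalois K₀ K → IsCyclic (K ≃ₐ[K₀] K) → (Module.finrank K₀ K).Prime → Module.finrank K₀ K = 2 →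
    ∀ (m : ℕ) (hK : isCompact_glFiniteIntegralLevel m K), 0 < m →
    ∀ (π : CuspidalAutomorphicRepData m K hK), π.1.IsLAlgebraic →
    ∀ (ℓ : ℕ) [Fact ℓ.Prime] (ι : PadicAlgCl ℓ ≃+* ℂ),
      UniformTwistPackages K₀ ι π.1 → HasAvatar ι π.1

/-- **CTU_odd = `OddCyclicTwistUnscrewing`** — CTU for `[K:K₀]` an odd prime · PRINT-grade (`p`-term
unscrewing `TwistedSum.exists_framedRep_of_cyclic_twist` with `d := m`, or PSPD's two-package restriction
rigidity) · leaf ATTACKABLE NOW (est. M–L). [ref: Taylor 1994 §3; route PrimeTwistSeparationLadder, crux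
CriticalPrimeDegreeDescent (stmt-Langlands-28517), stub PrimeStepPackageDescent] -/
def OddCyclicTwistUnscrewing : Prop :=
  ∀ (K₀ : Type) [Field K₀] [NumberField K₀] (K : Type) [Field K] [NumberField K] [Algebra K₀ K],
    IsGalois K₀ K → IsCyclic (K ≃ₐ[K₀] K) → (Module.finrank K₀ K).Prime → Module.finrank K₀ K ≠ 2 →
    ∀ (m : ℕ) (hK : isCompact_glFiniteIntegralLevel m K), 0 < m →
    ∀ (π : CuspidalAutomorphicRepData m K hK), π.1.IsLAlgebraic →
    ∀ (ℓ : ℕ) [Fact ℓ.Prime] (ι : PadicAlgCl ℓ ≃+* ℂ),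
      UniformTwistPackages K₀ ι π.1 → HasAvatar ι π.1

/-! ## Kernel: UNMIX ⟸ TOP ∧ CTU (by name) -/

/-- **UNMIX ⟸ TOP ∧ CTU**: compose. [folklore] -/
theorem conjugateUnmixing_of_pieces (hT : TwistOrbitPackages) (hC : CyclicTwistUnscrewing) :
    CyclicDeinductionCarving.ConjugateUnmixing := by
  intro K₀ _ _ K _ _ _ hG hc hp m hK hm π hπ ℓ _ ι hr
  exact hC K₀ K hG hc hp m hK hm π hπ ℓ ι (hT K₀ K hG hc hp m hK hm π hπ ℓ ι hr)

/-- **CTU ⟺ CTU₂ ∧ CTU_odd** (case split on `[K:K₀] = 2`). [folklore] -/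
theorem cyclicTwistUnscrewing_iff_two_odd :
    CyclicTwistUnscrewing ↔ QuadraticTwistUnscrewing ∧ OddCyclicTwistUnscrewing := by
  constructor
  · intro h
    exact ⟨fun K₀ _ _ K _ _ _ hG hc hp _ m hK hm π hπ ℓ _ ι hP => h K₀ K hG hc hp m hK hm π hπ ℓ ι hP,
      fun K₀ _ _ K _ _ _ hG hc hp _ m hK hm π hπ ℓ _ ι hP => h K₀ K hG hc hp m hK hm π hπ ℓ ι hP⟩
  · rintro ⟨h2, hodd⟩ K₀ _ _ K _ _ _ hG hc hp m hK hm π hπ ℓ _ ι hP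
    by_cases h : Module.finrank K₀ K = 2
    · exact h2 K₀ K hG hc hp h m hK hm π hπ ℓ ι hP
    · exact hodd K₀ K hG hc hp h m hK hm π hπ ℓ ι hP

/-! ## Necessity certificates: both pieces are implied by UNMIX (hence by E, hence by the summit) -/

section Lemmas

variable {K : Type} [Field K] [NumberField K]

/-- Twisting a multiset of Satake parameters by the trivial character does nothing. [folklore] -/
theorem multiset_map_mul_valueAtUniformizer_one (w : HeightOneSpectrum (𝓞 K)) (s : Multiset ℂ) :
    s.map (· * (1 : HeckeCharacter K).valueAtUniformizer w) = s := by
  simp [HeckeCharacter.valueAtUniformizer_one]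

end Lemmas

/-- **UNMIX ⇒ CTU**: the `χ = 1` member of a uniform package family is a pre-avatar (off `T`), which UNMIX unmixes. [folklore] -/
theorem cyclicTwistUnscrewing_of_conjugateUnmixing (h : CyclicDeinductionCarving.ConjugateUnmixing) :
    CyclicTwistUnscrewing := by
  intro K₀ _ _ K _ _ _ hG hc hp m hK hm π hπ ℓ _ ι hP
  obtain ⟨T, hT, hall⟩ := hP
  obtain ⟨r, hr, hpk⟩ := hall 1 (show (1 : HeckeCharacter K).IsFiniteOrder from IsOfFinOrder.one)
  refine h K₀ K hG hc hp m hK hm π hπ ℓ ι ⟨r, hr, ?_⟩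
  filter_upwards [hT.compl_mem_cofinite] with v hv
  intro β hβ
  obtain ⟨γ, hγ, hprod⟩ := hpk v hv (fun w _ => HeckeCharacter.isUnramifiedAt_one w) β hβ
  refine ⟨fun w => arithFrobPolyOfSatake ι w.residueCard 1 (γ w), hγ, ?_⟩
  simpa only [multiset_map_mul_valueAtUniformizer_one, Set.mem_setOf_eq] using hprod

/-- **UNMIX ⇒ TOP**: the avatar `ρ` produced by UNMIX is, for EVERY `χ`, a `χ`-twisted package recorded
untwisted (`γ := β`, the identity is `rfl`), above every place of `K₀` all of whose places of `K` are
`ρ`-compatible — a cofinite set independent of `χ` (`CyclicDeinduction.eventually_forall_over`); the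
Frobenius polynomial at `w` is `P^ι(β_w)` for the GIVEN `β_w` by uniqueness of Satake parameters
(`AutomorphicRepData.hasSatakeParamAt_unique_holds`, Flath 1979 Thm. 3). [cite: FlathCorvallis1979, Thm. 3] -/
theorem twistOrbitPackages_of_conjugateUnmixing (h : CyclicDeinductionCarving.ConjugateUnmixing) :
    TwistOrbitPackages := by
  intro K₀ _ _ K _ _ _ hG hc hp m hK hm π hπ ℓ _ ι hr
  obtain ⟨ρ, hρ, hcof⟩ := h K₀ K hG hc hp m hK hm π hπ ℓ ι hr
  have h1 := CyclicDeinduction.eventually_forall_over (K₀ := K₀) hcof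
  rw [Filter.eventually_cofinite] at h1
  refine ⟨{v : HeightOneSpectrum (𝓞 K₀) | ¬ ∀ w : HeightOneSpectrum (𝓞 K),
      w.asIdeal.under (𝓞 K₀) = v.asIdeal → SatakeFrobCompatibleAt ι π.1 ρ w}, h1, fun χ _ => ⟨ρ, hρ, ?_⟩⟩
  intro v hv _ β hβ
  simp only [Set.mem_setOf_eq, not_not] at hv
  refine ⟨β, fun w hw => ?_, rfl⟩
  obtain ⟨α, hα, hunr, hfrob⟩ := hv w hw
  obtain rfl : α = β w := AutomorphicRepData.hasSatakeParamAt_unique_holds π.1 hα (hβ w hw)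
  exact ⟨hunr, hfrob⟩

/-- **UNMIX ⟺ TOP ∧ CTU** (the decomposition is exact). [folklore] -/
theorem conjugateUnmixing_iff_pieces :
    CyclicDeinductionCarving.ConjugateUnmixing ↔ TwistOrbitPackages ∧ CyclicTwistUnscrewing :=
  ⟨fun h => ⟨twistOrbitPackages_of_conjugateUnmixing h, cyclicTwistUnscrewing_of_conjugateUnmixing h⟩,
    fun h => conjugateUnmixing_of_pieces h.1 h.2⟩

/-- E ⇒ UNMIX (the conclusion of UNMIX is E's; cf. `CyclicDeinduction.unmixing_of_semisimpleAvatar`). [folklore] -/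
theorem conjugateUnmixing_of_semisimpleAvatar (hE : RootDecomp1.SemisimpleAvatar) :
    CyclicDeinductionCarving.ConjugateUnmixing := by
  intro K₀ _ _ K _ _ _ _ _ _ m hK hm π hπ ℓ _ ι _
  exact hE K m hK hm π hπ ℓ ι

/-- **E ⇒ TOP ∧ CTU ∧ CTU₂ ∧ CTU_odd**: every piece is implied by E = `RootDecomp1.SemisimpleAvatar`
(stmt-Langlands-23598), hence by the summit. [folklore] -/
theorem pieces_of_semisimpleAvatar (hE : RootDecomp1.SemisimpleAvatar) :
    TwistOrbitPackages ∧ CyclicTwistUnscrewing ∧ QuadraticTwistUnscrewing ∧ OddCyclicTwistUnscrewing :=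
  have hU := conjugateUnmixing_of_semisimpleAvatar hE
  have hC := cyclicTwistUnscrewing_of_conjugateUnmixing hU
  ⟨twistOrbitPackages_of_conjugateUnmixing hU, hC, (cyclicTwistUnscrewing_iff_two_odd.mp hC).1,
    (cyclicTwistUnscrewing_iff_two_odd.mp hC).2⟩

/-- **G ⟸ G⁺ ∧ TOP ∧ CTU given the host's PROVED / open transports** (the host route's `closes` with UNMIX
replaced by TOP ∧ CTU and IND discharged by the tree theorem `Theorems.inducedPreAvatar_proof`). [cite: ArthurClozel1989, Ch. 3 §6] -/
theorem darkPrimitiveAvatars_of_pieces (hG : CyclicDeinductionCarving.InsolubleDarkAvatars)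
    (hT : TwistOrbitPackages) (hC : CyclicTwistUnscrewing)
    (hAcc : RootDecomp1.AccessibleAvatars) (hD : RootDecomp1.AvatarDescent)
    (hR : RootDecomp1.RestrictionTwistTransport) (hI : RootDecomp1.InductionTransport)
    (hV : RootDecomp1.DualTransport) : RootDecomp1.DarkPrimitiveAvatars :=
  CyclicDeinductionCarving.closes hG (conjugateUnmixing_of_pieces hT hC)
    inducedPreAvatar_proof hAcc hD hR hI hV

end Summit.Langlands.Langlands.Theorems.TwistOrbitUnmixing
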